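import Summits.NavierStokesRegularity.FluidComputer.GateBudgetSwingFloorCorot
import Summits.NavierStokesRegularity.FluidComputer.GateBudgetSwingPrice
import HarnessLib

/-!
# GateBudget part 115 — the swing transfer from below, VII: the cross-term floor (§305–§306)

Cell `pub-fluidc`, blueprint seat bp1 (gen 39, tenth item); namespace
`Summit.NavierStokesRegularity.FluidComputer.GateBudget`, headline family
`RotorKnob.rotorCircuit K K¹⁰ ε ρ` (modes `0 = a` carrier, `1 = b` clock, `2 = c` trigger,
`3 = d` transfer, `4 = ã` output) from `delayInit`, trigger primitive `C` (`C' = c`), on the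
UNIT lattice `ε = K¹⁰ρ²`. Imports part 114 (`GateBudgetSwingFloorCorot`: the co-rotating lock,
the signed band floor, the headline band floor with `A = a(r)² + d(r)²`; through it parts
109–111) and part 104 (`GateBudgetSwingPrice`: the windows; through it part 103).
HONEST FRAMING: a low prior, high value-of-information experiment on Tao's machine paradigm;
NOT a claim that NS blows up. Nothing here is about the Navier–Stokes equations.

THE POINT (SPEC-INPUT-bp1 §CK(3)(b); the cross-term floor, second file). Part 114 §304 bounds
one band swing of the headline member from below by `COEF·BRACKET` with
`COEF = K·A·η/(ε⁻¹K¹⁰κR₂) ≥ (999/1000)·A/(θK⁹)`, `A = a(r)² + d(r)²`, and `BRACKET =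
(cos 2ψ₁ + cos 2ψ₂)(cos α₁ - ℓ) - 2σ(1 - sin α₁) + 2E₁(log sin(α₁/2) - log cos(α₁/2))`
(`κ = 9999/10000`, `ℓ = (1 - κ)π/2 + 10⁻⁵`, `σ = π/9999 + 2/10⁵`, `E₁ = 6L(T' - r)/A
+ π/9999`), where now `ψ₁ = ψ₀ + φ₀`, `ψ₂ = -(ψ₁ + π + s)` carry the pair phase
`φ₀ = arctan(d(r)/a(r))` on top of part 104's small offset `ψ₀ = (C(t₁) - C(r))/ρ² - α₁
∈ [-0.0030, 0.0062]` and band excess `s ∈ [-0.0022, 0.0004]`. This file prices BRACKET.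
(§305) `cos 2ψ₁ + cos 2ψ₂ ≥ 2cos 2φ₀ - 2|ψ₀| - 2|ψ₀ + s|` (`cos` is `1`-Lipschitz;
`2ψ₂ ≡ -(2ψ₁ + 2s) mod 2π`), and the co-rotating cosine `(a² + d²)cos(2 arctan(d/a))
= a² - d²` EXACTLY; hence, on the windows, with `cos α₁ = y ∈ [31/32, (31/32)(1 + 2/10⁵)]`,
`A ≥ 0`, `A cos 2φ₀ ≥ 0`, `E₁ ≥ 0`:
`A·BRACKET ≥ 1.937·(A cos 2φ₀) - 0.0254·A - 4.159·(A·E₁)`.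
(§306) THE HEADLINE SWING FLOOR WITH THE CROSS TERM: under EXACTLY the hypotheses of part 104
§286 / part 112 §299(a) (pulse `[r, T']`, `T' - r ≤ 242/K⁹`, `c(r) = ρ²/K⁹`, kept ring,
`c > 0`, `a(r) ≠ 0`, the symmetric band with the dose sandwich at `t₁`) plus ONE — the transfer
mode is not dominant at ignition, `2d(r)² ≤ a(r)²` (then `cos 2φ₀ ≥ 1/3`, so part 110 §294's
`cos 2ψ₁ + cos 2ψ₂ ≥ 0` holds) —
`ã(t₂) - ã(t₁) ≥ (999/1000)/(θK⁹)·(1.937(a(r)² - d(r)²) - 0.027(a(r)² + d(r)²) - 4.16·W)`,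
`W = 6(ε + ρ²e^{-K¹⁰} + Kã(T'))(T' - r)`. Part 112 §299(a): `(999/1000)(a(r)²/(θK⁹))(1.916
- 4.16E)` with `E·a(r)² = |d(r)| + d(r)² + W` — the transfer at ignition now costs `1.964d(r)²`
instead of `4.16|d(r)| + 6.08d(r)²`: at `|d(r)| = 0.14` the new floor is `≈ 1.82/(θK⁹)`, the
old one `≈ 1.18/(θK⁹)`; the sequel (part 116) re-counts part 72 §219 with it for ALL clean
small-pair runs, without part 113's `|d(rₙ)| ≤ 10⁻³`.

* §305 `cos_pair_offset_ge` (the cosine pair); `corot_cos_two` (`A cos 2φ₀ = a² - d²`);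
  `swing_price_corot_ge` (THE BRACKET PRICED, pure real analysis).
* §306 `swing_headline_floor_corot` (THE HEADLINE SWING FLOOR WITH THE CROSS TERM).

NUMBERS. `2(31/32 - 1675/10⁷) = 1.937165 ≥ 1.937`; `2|ψ₀| + 2|ψ₀ + s| ≤ 0.0124 + 0.0132
= 0.0256`, `× y ≤ 0.96877`: `0.0248005`; `2σ(1 - sin α₁) ≤ 2·3.3504·10⁻⁴·0.7521 ≤ 5.04·10⁻⁴`;
sum `0.0253045 ≤ 0.0254`; `2·2.0795 = 4.159`; `4.159·π/9999 ≤ 0.00131`, `0.0254 + 0.00131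
≤ 0.027`; `4.159 ≤ 4.16`. On a clean ignition (`b² + c² ≤ 10⁻⁶`, `d² + ã² ≤ 1/50`, `W ≤ 10⁻⁴`):
`1.937(a² - d²) - 0.027(a² + d²) = 1.91(1 - b² - c² - ã²) - 3.874d² ≥ 1.91 - 2·10⁻⁶ - 3.874/50
= 1.8325`, floor `≥ 0.999·(1.8325 - 0.0005)/θ ≥ 1.83/(θK⁹)` (part 113: `1.87/(θK⁹)` only for
`|d(r)| ≤ 10⁻³`; part 72: `1/K⁹`).
HONEST LIMITS. (i) `k = 1` (unit lattice), as parts 100–114; (ii) the hypothesis `2d(r)² ≤ a(r)²`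
is what keeps `cos 2ψ₁ + cos 2ψ₂ ≥ 0` (part 110 §294) — on a clean ignition `d² ≤ 0.02 ≤ a²/2`;
for a dominant transfer the floor is part 71's; (iii) `W` is left symbolic (`≤ 10⁻⁴` on a pulse,
part 113 §300); (iv) the re-count is part 116; (v) nothing about NS.
[cite: Tao2016AveragedNS, §5.5 Theorem 5.3, (5.5), (b-eq), (c-eq), (d-eq), (ta-eq),
(energy-con)]
-/

noncomputable section

namespace Summit.NavierStokesRegularity.FluidComputer.GateBudget

open Real Set Filter Topology
open Literature.Analysis.FluidPDE.Tao2016AveragedNS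

variable {K M ε ρ : ℝ} {X : ℝ → Fin 5 → ℝ} {C : ℝ → ℝ}

/-! ## §305 The bracket priced -/

/-- §305(a) THE COSINE PAIR: for offsets `ψ₁ = ψ₀ + φ₀`, `ψ₂ = -(ψ₁ + π + s)`,
`cos 2ψ₁ + cos 2ψ₂ ≥ 2cos 2φ₀ - 2|ψ₀| - 2|ψ₀ + s|` (`cos² - sin² = cos 2·`;
`cos 2ψ₂ = cos(2ψ₁ + 2s)`; `cos` is `1`-Lipschitz).
[derived: Mathlib (`Real.cos_two_mul`, `Real.cos_add_two_pi`, `Real.abs_cos_sub_cos_le`)] -/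
theorem cos_pair_offset_ge {ψ₀ φ₀ s ψ₁ ψ₂ : ℝ} (hψ₁ : ψ₁ = ψ₀ + φ₀)
    (hψ₂ : ψ₂ = -(ψ₁ + π + s)) :
    2 * cos (2 * φ₀) - 2 * |ψ₀| - 2 * |ψ₀ + s|
      ≤ cos ψ₁ ^ 2 - sin ψ₁ ^ 2 + (cos ψ₂ ^ 2 - sin ψ₂ ^ 2) := by
  have hF : cos ψ₁ ^ 2 - sin ψ₁ ^ 2 + (cos ψ₂ ^ 2 - sin ψ₂ ^ 2)
      = cos (2 * ψ₁) + cos (2 * ψ₂) := by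
    rw [cos_two_mul, cos_two_mul]
    linarith only [sin_sq_add_cos_sq ψ₁, sin_sq_add_cos_sq ψ₂]
  have e2 : cos (2 * ψ₂) = cos (2 * ψ₁ + 2 * s) := by
    rw [hψ₂, show 2 * -(ψ₁ + π + s) = -((2 * ψ₁ + 2 * s) + 2 * π) by ring, cos_neg,
      cos_add_two_pi]
  have h1 := Real.abs_cos_sub_cos_le (2 * φ₀) (2 * ψ₁)
  have h2 := Real.abs_cos_sub_cos_le (2 * φ₀) (2 * ψ₁ + 2 * s)
  rw [hψ₁] at h1 h2
  rw [show 2 * φ₀ - 2 * (ψ₀ + φ₀) = -(2 * ψ₀) by ring, abs_neg, abs_mul, abs_two] at h1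
  rw [show 2 * φ₀ - (2 * (ψ₀ + φ₀) + 2 * s) = -(2 * (ψ₀ + s)) by ring, abs_neg, abs_mul,
    abs_two] at h2
  rw [hF, e2, hψ₁]
  linarith only [(abs_le.1 h1).2, (abs_le.1 h2).2]

/-- §305(b) THE CO-ROTATING COSINE: `(a² + d²)·cos(2 arctan(d/a)) = a² - d²` for `a ≠ 0`
(`cos 2x = 2cos²x - 1`, `cos²(arctan u) = 1/(1 + u²)`); with part 114 §303(a): the pair energy
`A = a² + d²` and pair phase `φ₀ = arctan(d/a)` have `A cos 2φ₀ = a² - d²`, `A sin 2φ₀ = 2ad`.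
[derived: Mathlib (`Real.cos_two_mul`, `Real.cos_sq_arctan`)] -/
theorem corot_cos_two {a d : ℝ} (ha : a ≠ 0) :
    (a ^ 2 + d ^ 2) * cos (2 * arctan (d / a)) = a ^ 2 - d ^ 2 := by
  rw [cos_two_mul, cos_sq_arctan]
  field_simp
  ring

/-- §305(c) THE BRACKET PRICED (pure real analysis): for an edge cosine
`y ∈ [31/32, (31/32)(1 + 2/10⁵)]`, `α₁ = arccos y`, offsets `ψ₁ = ψ₀ + φ₀`, `ψ₂ = -(ψ₁ + π + s)`
with `ψ₀ ∈ [-0.0030, 0.0062]`, `s ∈ [-0.0022, 0.0004]` (part 104 §285's windows), a pair energy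
`A ≥ 0` with `A cos 2φ₀ ≥ 0`, and a drift `E₁ ≥ 0`, the bracket of part 114 §304 satisfies
`A·BRACKET ≥ 1.937·(A cos 2φ₀) - 0.0254·A - 4.159·(A E₁)` (§305(a); `(1 - κ)π/2 + 10⁻⁵
≤ 1675/10⁷`, `cos α₁ - ℓ ∈ [y - 1675/10⁷, 0.96877]`; `2σ(1 - sin α₁) ≤ 5.04·10⁻⁴` with
`sin α₁ ≥ 0.2479`; `log sin(α₁/2) - log cos(α₁/2) = -½ log((1 + y)/(1 - y)) ≥ -3 log 2
≥ -2.0795` as in part 112 §298).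
[derived: this file §305(a); part 112 §298 (the logarithm); Mathlib (`Real.cos_arccos`,
`Real.sin_arccos`, `Real.cos_sq`, `Real.log_two_lt_d9`, `Real.pi_lt_d2`)] -/
theorem swing_price_corot_ge {y α₁ ψ₀ φ₀ s ψ₁ ψ₂ A E₁ : ℝ} (hy1 : 31 / 32 ≤ y)
    (hy2 : y ≤ 31 / 32 * (1 + 2 / 10 ^ 5)) (hα₁ : α₁ = arccos y) (hψlo : -(30 / 10000) ≤ ψ₀)
    (hψhi : ψ₀ ≤ 62 / 10000) (hslo : -(22 / 10000) ≤ s) (hshi : s ≤ 4 / 10000)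
    (hψ₁ : ψ₁ = ψ₀ + φ₀) (hψ₂ : ψ₂ = -(ψ₁ + π + s)) (hA : 0 ≤ A)
    (hP : 0 ≤ A * cos (2 * φ₀)) (hE₁ : 0 ≤ E₁) :
    1937 / 1000 * (A * cos (2 * φ₀)) - 254 / 10 ^ 4 * A - 4159 / 1000 * (A * E₁)
      ≤ A * ((cos ψ₁ ^ 2 - sin ψ₁ ^ 2 + (cos ψ₂ ^ 2 - sin ψ₂ ^ 2))
            * (cos α₁ - ((1 - 9999 / 10000) * (π / 2) + 1 / 10 ^ 5))
          - 2 * (π * ((9999 / 10000 : ℝ)⁻¹ - 1) + 2 * (1 / 10 ^ 5)) * (1 - sin α₁)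
          + 2 * E₁ * (log (sin (α₁ / 2)) - log (cos (α₁ / 2)))) := by
  have hy0 : 0 ≤ y := by linarith
  have hy3 : y < 1 := by linarith
  have hcos : cos α₁ = y := by rw [hα₁]; exact cos_arccos (by linarith) hy3.le
  have hsin : sin α₁ = √(1 - y ^ 2) := by rw [hα₁, sin_arccos]
  have hs1 : 2479 / 10000 ≤ sin α₁ := by
    rw [hsin]
    calc (2479 / 10000 : ℝ) = √((2479 / 10000) ^ 2) := (sqrt_sq (by norm_num)).symm
      _ ≤ √(1 - y ^ 2) := sqrt_le_sqrt (by nlinarith [mul_nonneg (sub_nonneg.2 hy2) hy0])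
  have hs2 : sin α₁ ≤ 1 := sin_le_one _
  have hπ := Real.pi_lt_d2
  have hπ0 := Real.pi_pos
  -- the cosine pair against the angle factor `G = cos α₁ - ℓ ∈ [y - 1675/10⁷, 0.96877]`
  have hF := cos_pair_offset_ge hψ₁ hψ₂
  have habs : 2 * |ψ₀| + 2 * |ψ₀ + s| ≤ 256 / 10000 := by
    have a1 : |ψ₀| ≤ 62 / 10000 := abs_le.2 ⟨by linarith, hψhi⟩
    have a2 : |ψ₀ + s| ≤ 66 / 10000 := abs_le.2 ⟨by linarith, by linarith⟩
    linarith only [a1, a2]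
  have hG : y - 1675 / 10 ^ 7 ≤ cos α₁ - ((1 - 9999 / 10000) * (π / 2) + 1 / 10 ^ 5) := by
    rw [hcos]; linarith
  have hG0 : 0 ≤ cos α₁ - ((1 - 9999 / 10000) * (π / 2) + 1 / 10 ^ 5) := by linarith
  have hGhi : cos α₁ - ((1 - 9999 / 10000) * (π / 2) + 1 / 10 ^ 5) ≤ 96877 / 100000 := by
    rw [hcos]; linarith
  have hAG : 0 ≤ A * (cos α₁ - ((1 - 9999 / 10000) * (π / 2) + 1 / 10 ^ 5)) :=
    mul_nonneg hA hG0
  have i1 := mul_le_mul_of_nonneg_left hF hAG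
  have i2 : A * cos (2 * φ₀) * (1937 / 1000)
      ≤ A * cos (2 * φ₀) * (2 * (cos α₁ - ((1 - 9999 / 10000) * (π / 2) + 1 / 10 ^ 5))) :=
    mul_le_mul_of_nonneg_left (by linarith) hP
  have i3 : A * (cos α₁ - ((1 - 9999 / 10000) * (π / 2) + 1 / 10 ^ 5))
      * (2 * |ψ₀| + 2 * |ψ₀ + s|) ≤ A * (96877 / 100000) * (256 / 10000) :=
    mul_le_mul (mul_le_mul_of_nonneg_left hGhi hA) habs (by positivity) (by positivity)
  -- the sine term `2σ(1 - sin α₁) ≤ 5.04·10⁻⁴`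
  have i4 : 2 * (π * ((9999 / 10000 : ℝ)⁻¹ - 1) + 2 * (1 / 10 ^ 5)) * (1 - sin α₁)
      ≤ 504 / 10 ^ 6 := by
    have h9 : ((9999 / 10000 : ℝ)⁻¹ - 1) = 1 / 9999 := by norm_num
    rw [h9]
    have hσ : 2 * (π * (1 / 9999) + 2 * (1 / 10 ^ 5)) ≤ 6701 / 10 ^ 7 := by
      linarith only [hπ]
    calc 2 * (π * (1 / 9999) + 2 * (1 / 10 ^ 5)) * (1 - sin α₁)
        ≤ 6701 / 10 ^ 7 * (7521 / 10000) :=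
          mul_le_mul hσ (by linarith) (by linarith) (by norm_num)
      _ ≤ 504 / 10 ^ 6 := by norm_num
  have i5 := mul_le_mul_of_nonneg_left i4 hA
  -- the half-angle logarithm (part 112 §298 verbatim)
  have hc2 : cos (α₁ / 2) ^ 2 = (1 + y) / 2 := by
    rw [cos_sq, show 2 * (α₁ / 2) = α₁ by ring, hcos]; ring
  have hs2' : sin (α₁ / 2) ^ 2 = (1 - y) / 2 := by rw [sin_sq, hc2]; ring
  have e1 : log ((1 - y) / 2) = 2 * log (sin (α₁ / 2)) := by
    rw [← hs2', Real.log_pow]; norm_num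
  have e2 : log ((1 + y) / 2) = 2 * log (cos (α₁ / 2)) := by
    rw [← hc2, Real.log_pow]; norm_num
  rw [Real.log_div (show (0 : ℝ) < 1 - y by linarith).ne' (by norm_num)] at e1
  rw [Real.log_div (show (0 : ℝ) < 1 + y by linarith).ne' (by norm_num)] at e2
  have hL : log (1 + y) - log (1 - y) ≤ 6 * log 2 := by
    rw [← Real.log_div (show (0 : ℝ) < 1 + y by linarith).ne'
      (show (0 : ℝ) < 1 - y by linarith).ne']
    have h64 : (1 + y) / (1 - y) ≤ 2 ^ 6 := by
      rw [div_le_iff₀ (by linarith)]; linarith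
    calc log ((1 + y) / (1 - y)) ≤ log (2 ^ 6) :=
          Real.log_le_log (div_pos (by linarith) (by linarith)) h64
      _ = 6 * log 2 := by rw [Real.log_pow]; norm_num
  have hlog2 := Real.log_two_lt_d9
  have h3 : -(20795 / 10000 * (2 * E₁))
      ≤ 2 * E₁ * (log (sin (α₁ / 2)) - log (cos (α₁ / 2))) := by
    have hℓ : log (sin (α₁ / 2)) - log (cos (α₁ / 2)) = -((log (1 + y) - log (1 - y)) / 2) := by
      linarith
    rw [hℓ]
    have hE2 : 0 ≤ 2 * E₁ := by linarith
    calc -(20795 / 10000 * (2 * E₁)) = 2 * E₁ * (-(20795 / 10000)) := by ring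
      _ ≤ 2 * E₁ * (-((log (1 + y) - log (1 - y)) / 2)) :=
          mul_le_mul_of_nonneg_left (by linarith) hE2
  have i6 := mul_le_mul_of_nonneg_left h3 hA
  linarith only [i1, i2, i3, i5, i6, hA]

/-! ## §306 The headline swing floor with the cross term -/

/-- §306 THE HEADLINE SWING FLOOR WITH THE CROSS TERM (EXACTLY the hypotheses of part 104 §286
`swing_headline_price` / part 112 §299(a): headline member `K ≥ 16`, `ε > 0`, UNIT LATTICE
`ε = K¹⁰ρ²`, `θ ≥ 5/4`; a pulse start `r ≥ 0` with `c(r) = ρ²/K⁹`, an end `T' ≤ r + 242/K⁹`,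
the kept ring `θ²ε² - ε²/10⁶ ≤ b² + c² ≤ θ²ε² + 2ε²/10⁶` and `c > 0` on `[r, T']`, `a(r) ≠ 0`;
the symmetric band `r ≤ t₁ ≤ t₂ ≤ T'`, `b(t₁) = (31/32)θε = -b(t₂)`, `|b| ≤ (31/32)θε` on
`[t₁, t₂]`, the dose sandwich at `t₁` — part 100 §277 `pulse_swing_band` supplies all of it —
PLUS ONE: `2d(r)² ≤ a(r)²`; `W = 6(ε + ρ²e^{-K¹⁰} + Kã(T'))(T' - r)`):
`ã(t₂) - ã(t₁) ≥ (999/1000)/(θK⁹)·(1.937(a(r)² - d(r)²) - 0.027(a(r)² + d(r)²) - 4.16W)`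
(part 114 §304 with `A = a² + d²`, `φ₀ = arctan(d/a)`: part 104 §285's windows give
`ψ₀ ∈ [-0.0030, 0.0062]`, `s ∈ [-0.0022, 0.0004]`; §305(b),(a) give `A cos 2φ₀ = a² - d² ≥ A/3`,
so `cos 2ψ₁ + cos 2ψ₂ ≥ 2/3 - 0.0256 ≥ 0`; §305(c) prices the bracket, `A·E₁ = W + Aπ/9999`;
part 111 §297(c) prices the coefficient; if the closed form is negative, monotonicity of `ã`).
[derived: part 114 §304; part 104 §285; part 111 §297(c); this file §305; RotorKnob
(`rotorCircuit_output_monotone`, `e_nonneg`)] -/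
theorem swing_headline_floor_corot
    (hX : ∀ t, HasDerivAt X (RotorKnob.rotorCircuit K (K ^ 10) ε ρ (X t)) t)
    (h0 : X 0 = delayInit) (hC : ∀ t, HasDerivAt C (X t 2) t) (hK : 16 ≤ K) (hε : 0 < ε)
    (hlat : ε = K ^ 10 * ρ ^ 2) {r t₁ t₂ T' θ : ℝ} (hr : 0 ≤ r) (hrt : r ≤ t₁) (ht : t₁ ≤ t₂)
    (htT : t₂ ≤ T') (hτ : T' - r ≤ 242 / K ^ 9) (hθ1 : 5 / 4 ≤ θ) (ha : X r 0 ≠ 0)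
    (had : 2 * X r 3 ^ 2 ≤ X r 0 ^ 2) (hcr : X r 2 = ρ ^ 2 / K ^ 9)
    (hring : ∀ u ∈ Icc r T', θ ^ 2 * ε ^ 2 - ε ^ 2 / 10 ^ 6 ≤ X u 1 ^ 2 + X u 2 ^ 2 ∧
      X u 1 ^ 2 + X u 2 ^ 2 ≤ θ ^ 2 * ε ^ 2 + 2 * ε ^ 2 / 10 ^ 6)
    (hpos : ∀ u ∈ Icc r T', 0 < X u 2) (hb1 : X t₁ 1 = 31 / 32 * θ * ε)
    (hb2 : X t₂ 1 = -(31 / 32 * θ * ε))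
    (hband : ∀ u ∈ Icc t₁ t₂, -(31 / 32 * θ * ε) ≤ X u 1 ∧ X u 1 ≤ 31 / 32 * θ * ε)
    (hdlo : 31 / 32 * θ * K ^ 10 * (C t₁ - C r) ≤ X t₁ 2 - X r 2)
    (hdhi : X t₁ 2 - X r 2 ≤ (1 + 1 / 10 ^ 4) * θ * K ^ 10 * (C t₁ - C r)
      + ρ ^ 2 * exp (-K ^ 10) * (t₁ - r)) :
    999 / 1000 / (θ * K ^ 9) * (1937 / 1000 * (X r 0 ^ 2 - X r 3 ^ 2)
        - 27 / 1000 * (X r 0 ^ 2 + X r 3 ^ 2)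
        - 416 / 100 * (6 * (ε + ρ ^ 2 * exp (-K ^ 10) + K * X T' 4) * (T' - r)))
      ≤ X t₂ 4 - X t₁ 4 := by
  have hK0 : (0 : ℝ) < K := by linarith
  have hθ0 : (0 : ℝ) < θ := by linarith
  obtain ⟨R₂, hR₂⟩ : ∃ R₂ : ℝ, R₂ = √(θ ^ 2 * ε ^ 2 - ε ^ 2 / 10 ^ 6 - ε ^ 2 / K ^ 10) :=
    ⟨_, rfl⟩
  obtain ⟨α₁, hα₁⟩ : ∃ α₁ : ℝ, α₁ = arccos (31 / 32 * θ * ε / R₂) := ⟨_, rfl⟩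
  obtain ⟨A, hA⟩ : ∃ A : ℝ, A = X r 0 ^ 2 + X r 3 ^ 2 := ⟨_, rfl⟩
  obtain ⟨φ₀, hφ₀⟩ : ∃ φ₀ : ℝ, φ₀ = arctan (X r 3 / X r 0) := ⟨_, rfl⟩
  obtain ⟨ψ₀, hψ₀⟩ : ∃ ψ₀ : ℝ, ψ₀ = (C t₁ - C r) / ρ ^ 2 - α₁ := ⟨_, rfl⟩
  obtain ⟨ψ₁, hψ₁⟩ : ∃ ψ₁ : ℝ, ψ₁ = (C t₁ - C r) / ρ ^ 2 + φ₀ - α₁ := ⟨_, rfl⟩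
  obtain ⟨ψ₂, hψ₂⟩ : ∃ ψ₂ : ℝ,
      ψ₂ = -(α₁ + ((C t₁ - C r) / ρ ^ 2 + φ₀) + ε⁻¹ * K ^ 10 * (C t₂ - C t₁)) := ⟨_, rfl⟩
  obtain ⟨s, hs⟩ : ∃ s : ℝ, s = ε⁻¹ * K ^ 10 * (C t₂ - C t₁) - (π - 2 * α₁) := ⟨_, rfl⟩
  obtain ⟨W, hW⟩ : ∃ W : ℝ, W = 6 * (ε + ρ ^ 2 * exp (-K ^ 10) + K * X T' 4) * (T' - r) :=
    ⟨_, rfl⟩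
  obtain ⟨E, hE⟩ : ∃ E : ℝ,
      E = 6 * (ε + ρ ^ 2 * exp (-K ^ 10) + K * X T' 4) * (T' - r) / A := ⟨_, rfl⟩
  obtain ⟨E₁, hE₁⟩ : ∃ E₁ : ℝ, E₁ = E + π * ((9999 / 10000 : ℝ)⁻¹ - 1) := ⟨_, rfl⟩
  obtain ⟨η, hη⟩ : ∃ η : ℝ, η = 9999 / 10000
      / (1 + (2 * (1 / 10 ^ 5) + π / 2 * ((9999 / 10000 : ℝ)⁻¹ - 1)) / sin α₁) := ⟨_, rfl⟩
  rw [← hW]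
  obtain ⟨-, hy1, hy2⟩ := swing_coef_headline hK hε hθ1 (le_refl (0 : ℝ)) hR₂
  obtain ⟨hη9, -, hcoef⟩ := swing_coef_headline_ge hK hε hθ1 zero_le_one hR₂ hα₁ hη
  -- the windows (part 104 §285, as in part 112 §299(a))
  have hsub1 : t₁ ∈ Icc r T' := ⟨hrt, ht.trans htT⟩
  have hsubI : ∀ u ∈ Icc t₁ t₂, u ∈ Icc r T' := fun u hu => ⟨hrt.trans hu.1, hu.2.trans htT⟩
  obtain ⟨hΦ1, hΦ2⟩ := climb_phase_window hK hε hlat hθ1 hrt (by linarith only [hτ, hsub1.2])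
    hb1 hcr (hring t₁ hsub1) (hpos t₁ hsub1) hdlo hdhi
  obtain ⟨hαlo, hαhi⟩ := edge_angle_window (by linarith only [hy1]) hy2
  rw [← hα₁] at hαlo hαhi
  obtain ⟨hδ1, hδ2⟩ := band_excess_window hX h0 hC hK hε ht hθ1 (fun u hu => hring u (hsubI u hu))
    (fun u hu => hpos u (hsubI u hu)) hb1 hb2 hband hR₂ hα₁
  rw [← hs] at hδ1 hδ2
  have hψlo : -(30 / 10000) ≤ ψ₀ := by rw [hψ₀]; linarith only [hΦ1, hαhi]
  have hψhi : ψ₀ ≤ 62 / 10000 := by rw [hψ₀]; linarith only [hΦ2, hαlo]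
  have hψ₁' : ψ₁ = ψ₀ + φ₀ := by rw [hψ₁, hψ₀]; ring
  have hψ₂' : ψ₂ = -(ψ₁ + π + s) := by rw [hψ₂, hψ₁, hs]; ring
  -- the pair energy, the co-rotating cosine, `cos 2ψ₁ + cos 2ψ₂ ≥ 0`
  have hA0 : 0 < A := by
    have ha2 : 0 < X r 0 ^ 2 := lt_of_le_of_ne (sq_nonneg _) (Ne.symm (pow_ne_zero 2 ha))
    rw [hA]; linarith only [ha2, sq_nonneg (X r 3)]
  have hP : A * cos (2 * φ₀) = X r 0 ^ 2 - X r 3 ^ 2 := by rw [hA, hφ₀]; exact corot_cos_two ha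
  have hP0 : 0 ≤ A * cos (2 * φ₀) := by rw [hP]; linarith only [had, sq_nonneg (X r 3)]
  have hc3 : 1 / 3 ≤ cos (2 * φ₀) := by
    have h : A * (1 / 3) ≤ A * cos (2 * φ₀) := by rw [hP, hA]; linarith only [had]
    exact le_of_mul_le_mul_left h hA0
  have hF := cos_pair_offset_ge hψ₁' hψ₂'
  have habs1 : |ψ₀| ≤ 62 / 10000 := abs_le.2 ⟨by linarith only [hψlo], hψhi⟩
  have habs2 : |ψ₀ + s| ≤ 66 / 10000 :=
    abs_le.2 ⟨by linarith only [hψlo, hδ1], by linarith only [hψhi, hδ2]⟩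
  have hcψ : 0 ≤ cos ψ₁ ^ 2 - sin ψ₁ ^ 2 + (cos ψ₂ ^ 2 - sin ψ₂ ^ 2) := by
    linarith only [hF, habs1, habs2, hc3]
  -- the band floor of part 114 §304
  have hmain := swing_band_headline_ge_corot hX h0 hC hK hε hlat hr hrt ht htT hθ1 ha hring hpos
    hb1 hb2 hband hR₂ hA hφ₀ hE hα₁ hψ₁ hψ₂ hE₁ hη hcψ
  -- the drift: `A·E = W ≥ 0`, `A·E₁ = W + Aπ/9999`
  have hT0 : 0 ≤ T' := hr.trans (hrt.trans (ht.trans htT))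
  have he := RotorKnob.e_nonneg hX h0 hK0.le hT0
  have hτ0 : 0 ≤ T' - r := by linarith only [hrt, ht, htT]
  have hW0 : 0 ≤ W := by rw [hW]; positivity
  have hAE : A * E = W := by rw [hE, ← hW]; exact mul_div_cancel₀ _ hA0.ne'
  have hE0 : 0 ≤ E := by rw [hE, ← hW]; positivity
  have h9 : ((9999 / 10000 : ℝ)⁻¹ - 1) = 1 / 9999 := by norm_num
  rw [h9] at hE₁
  have hπ := Real.pi_lt_d2
  have hE₁0 : 0 ≤ E₁ := by rw [hE₁]; positivity
  have hprice := swing_price_corot_ge hy1 hy2 hα₁ hψlo hψhi hδ1 hδ2 hψ₁' hψ₂' hA0.le hP0 hE₁0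
  have hB : 1937 / 1000 * (X r 0 ^ 2 - X r 3 ^ 2) - 27 / 1000 * (X r 0 ^ 2 + X r 3 ^ 2)
        - 416 / 100 * W
      ≤ 1937 / 1000 * (A * cos (2 * φ₀)) - 254 / 10 ^ 4 * A - 4159 / 1000 * (A * E₁) := by
    have hAE₁ : A * E₁ = W + A * (π * (1 / 9999)) := by rw [hE₁, mul_add, hAE]
    have hAπ : A * π ≤ A * (315 / 100) :=
      mul_le_mul_of_nonneg_left (by linarith only [hπ]) hA0.le
    rw [hP, hAE₁, ← hA]
    linarith only [hAπ, hW0, hA0]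
  -- the coefficient (part 111 §297(c) with `A = 1`) and the assembly
  have hc0 : 0 ≤ 999 / 1000 / (θ * K ^ 9) := by positivity
  by_cases hB0 : 0 ≤ 1937 / 1000 * (X r 0 ^ 2 - X r 3 ^ 2) - 27 / 1000 * (X r 0 ^ 2 + X r 3 ^ 2)
      - 416 / 100 * W
  · have hη0 : 0 ≤ η := by linarith only [hη9]
    obtain ⟨hRpos, -⟩ := headline_band_radius hK hε hθ1 hR₂
    have hC0 : 0 ≤ K * η / (ε⁻¹ * K ^ 10 * (9999 / 10000) * R₂) := by positivity
    have hcoef' : 999 / 1000 / (θ * K ^ 9) ≤ K * η / (ε⁻¹ * K ^ 10 * (9999 / 10000) * R₂) := by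
      have e1 : (999 / 1000 / (θ * K ^ 9) : ℝ) = 999 / 1000 * 1 / (θ * K ^ 9) := by ring
      have e2 : K * η / (ε⁻¹ * K ^ 10 * (9999 / 10000) * R₂)
          = K * 1 * η / (ε⁻¹ * K ^ 10 * (9999 / 10000) * R₂) := by ring
      rw [e1, e2]; exact hcoef
    have e : ∀ x : ℝ, K * A * η / (ε⁻¹ * K ^ 10 * (9999 / 10000) * R₂) * x
        = K * η / (ε⁻¹ * K ^ 10 * (9999 / 10000) * R₂) * (A * x) := fun x => by ring
    rw [e] at hmain
    exact (mul_le_mul_of_nonneg_right hcoef' hB0).trans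
      ((mul_le_mul_of_nonneg_left (hB.trans hprice) hC0).trans hmain)
  · have hmono : X t₁ 4 ≤ X t₂ 4 := RotorKnob.rotorCircuit_output_monotone hK0.le hX ht
    have hneg : 999 / 1000 / (θ * K ^ 9) * (1937 / 1000 * (X r 0 ^ 2 - X r 3 ^ 2)
        - 27 / 1000 * (X r 0 ^ 2 + X r 3 ^ 2) - 416 / 100 * W) ≤ 0 :=
      mul_nonpos_of_nonneg_of_nonpos hc0 (le_of_lt (not_le.1 hB0))
    linarith only [hmono, hneg]

end Summit.NavierStokesRegularity.FluidComputer.GateBudget
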